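import Summits.BirchSwinnertonDyer.BirchSwinnertonDyer.Theorems.KimAtThreeDeepUpperDefectObstruction
import Literature.NumberTheory.EllipticCurves.BSDShaProofs
import HarnessLib

/-!
# Route `KimAtThreeKolyvagin` (rung W2), crux `DeepLowerAtThree` (item 19075): the SMALL-DEFECT slices —
# every row with `∂⁽⁰⁾(δ̃) ≤ ord₃ #Ш(E/ℚ)(3) + e` for a certified deep exponent `e`, unconditionally

Cell `bsd-addord`, seat `bsd-addord-w2-c2` (D-0074 row B5, gen 2), item `stmt-BirchSwinnertonDyer-19075`
(`Summit.BirchSwinnertonDyer.BirchSwinnertonDyer.Theses.KimAtThreeKolyvagin.DeepLowerAtThree`):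
on every tower row of analytic rank `0`, `∃ d, ∂^{(∞)}_{deep}(δ̃) = d ∧ ∂⁽⁰⁾(δ̃) ≤ ord₃ #Ш(E/ℚ)(3) + d`.
Write, at one row, `a = ∂⁽⁰⁾(δ̃)`, `d = ∂^{(∞)}_{deep}(δ̃)`, `s = ord₃ #Ш(E/ℚ)(3)`, `c = v₃(∏_ℓ c_ℓ)`.

HONEST FRAMING. Theorems only (no definition, no named fact minted, no `sorry`); every printed input
is a hypothesis BY NAME (Cassels–Tate `exists_casselsTate_pairing`, Gross–Zagier–Kolyvagin
`rank_eq_analyticRank_of_analyticRank_le_one`); nothing is asserted, nothing booked; crux 19075 stays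
OPEN. What this file records is WHICH ROWS of the crux are ALREADY theorems of the tree's
`∂`-bookkeeping, extending kim3's unit-`δ̃₁` calibration rung `deepLowerAtThree_of_unitLevelOne`
(p412633, the slice `a = 0`):

* §1 (general `p`, pure `ℕ∞`): since `d ≤ a < ⊤` always in analytic rank `0`
  (`kuriharaPartialDeepInfty_le_kuriharaPartial_zero`, kim3), the crux's conclusion at a row is
  EQUIVALENT to the bare inequality `a ≤ s + d` (`deepLower_conclusion_iff_le_add_deepInfty`), and it
  HOLDS as soon as `a ≤ s + e` for ANY exponent `e` with `e ≤ d` (`deepLower_conclusion_of_le_add_of_le_deepInfty`);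
  `e = 0`: every row with `a ≤ s` (`deepLower_conclusion_of_kuriharaPartial_zero_le`). So the
  mathematical content of 19075 at a row is exactly a LOWER bound `a − s ≤ d` on the deep
  divisibility of the Kurihara numbers — by Kim's Conj. 1.10 / the BSD formula the predicted value of
  `a − s` on a `3`-torsion-free row with unit period transfer is `c = v₃(∏ c_ℓ)`: «TAMAGAWA DIVISIBILITY
  OF DEEP KURIHARA NUMBERS», `c ≤ d` (the converse inequality `d ≤ c` is w2-c3's DDT).
* §2 (the crux at `p = 3`, crux binders verbatim + one slice binder):
  `deepLowerAtThree_of_kuriharaPartial_zero_le_sha` (slice `a ≤ s`; contains the unit slice `a = 0`);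
  `two_le_padicValNat_sha_three_of_casselsTate` (Cassels–Tate: `Ш(E)(3) ≠ 0 ⇒ 9 ∣ #Ш(E)`, so `2 ≤ s`);
  hence the registered stub shape `stub_lower_shaNontrivial` (`#Ш(E)(3) ≠ 1`) on the slice `a ≤ 2`
  GRANTED Cassels–Tate by name (`deepLowerAtThree_shaNontrivial_of_kuriharaPartial_zero_le_two_of_casselsTate`),
  and on the slice `a ≤ 1` with no fact at all (`deepLowerAtThree_shaNontrivial_of_kuriharaPartial_zero_le_one`).
* §3 (BSD currency, general odd `p` then `p = 3`): the LOWER half of `BSD_p` in Miller's form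
  (`Typed.MissingLowerBoundAt W p`: `ord_p #Ш_an ≤ ord_p #Ш`) gives `a ≤ s + c` on a rank-`0` row with
  `E[p]` irreducible and the `p`-adic period transfer (`kuriharaPartial_zero_le_sha_add_tamagawa_of_missingLowerBoundAt`,
  the converse of w2-c3's `missingLowerBoundAt_of_kuriharaPartial_zero_le`); hence 19075's conclusion
  at the row follows from `MissingLowerBoundAt W 3` ∧ «Tamagawa divisibility» `c ≤ d`
  (`deepLower_conclusion_of_missingLowerBoundAt_of_tamagawa_le_deepInfty`), in particular from
  `MissingLowerBoundAt W 3` alone on the rows with `3 ∤ ∏ c_ℓ`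
  (`deepLower_conclusion_of_missingLowerBoundAt_of_not_three_dvd_tamagawa`). Read together with
  w2-c3's `missingLowerBoundAt_three_of_deepDefectLe_of_deepLowerAtThree` (DDT ∧ 19075 ⇒ lower half):
  on the period-transfer rows, modulo the two Tamagawa inequalities `d ≤ c` / `c ≤ d`, crux 19075 IS
  the main-conjecture (lower) half of `BSD₃` — neither weaker nor stronger.

NOT here: any Euler-system input; the Tamagawa divisibility `c ≤ d` itself (Kim 2022 Conj. 1.10, `≥`
half — at `p = 3` the rigidity half of Kim 2025 Thm. 1.1 read through the dictionary, i.e. the crux on the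
complementary rows `a > s`). References: [Kim2022StructureSelmer] §1.4.3–1.5.1 (PDF p. 7), Conj. 1.10,
Thm. 1.9 (6); [Kim2025RefinedTNC] Thm. 1.1; [MazurRubin2004] Def. 4.5.7, 5.2.11, Thm. 5.2.12;
[SilvermanAEC2009] Thm. X.4.14, Ex. 10.20; [Miller2011LMS] Def. 1.1.
-/

set_option autoImplicit false
-- the Theorems namespace of a single-conjunct summit repeats the summit name by design (D-0017)
set_option linter.dupNamespace false
noncomputable section

open scoped MatrixGroups ModularForm Classical

open CongruenceSubgroup WeierstrassCurve Literature.NumberTheory.EllipticCurves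
  Literature.NumberTheory.EllipticCurves.ModularForms
  Literature.NumberTheory.EllipticCurves.Rank1Residual
  Literature.NumberTheory.EllipticCurves.Rank1Residual.Typed

namespace Summit.BirchSwinnertonDyer.BirchSwinnertonDyer.Theorems.KimAtThreeDeepLowerSmallDefect

open Summit.BirchSwinnertonDyer.Rank1Residual.Additive
open Summit.BirchSwinnertonDyer.Rank1Residual.Supersingular
open Summit.BirchSwinnertonDyer.BirchSwinnertonDyer.Theses.KimAtThreeKolyvagin
open Summit.BirchSwinnertonDyer.BirchSwinnertonDyer.Theorems.KimAtThreeKolyvaginDeepUpperRung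
open Summit.BirchSwinnertonDyer.BirchSwinnertonDyer.Theorems.KimAtThreeKolyvaginUnitLevelOneRungs
open Summit.BirchSwinnertonDyer.BirchSwinnertonDyer.Theorems.KimAtThreeKolyvaginCertificateDictionary
open Summit.BirchSwinnertonDyer.BirchSwinnertonDyer.Theorems.KimAtThreeKolyvaginDeepLowerOfCertificate
open Summit.BirchSwinnertonDyer.BirchSwinnertonDyer.Theorems.KimAtThreeDeepUpperDefectObstruction

/-! ### §1 `ℕ∞` bookkeeping at one row (general `p`): the crux is a lower bound on the deep limit -/

section Bookkeeping

variable (W : WeierstrassCurve ℚ) [W.IsGloballyMinimal] (p : ℕ) {N : ℕ} (f : CuspForm (Gamma0 N) 2)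

/-- **Crux 19075's conclusion at a row ⟺ `∂⁽⁰⁾ ≤ s + ∂^{(∞)}_{deep}`.** In analytic rank `0`
(`ord(δ̃) = 0`) the deep limit is automatically a natural number `d ≤ ∂⁽⁰⁾(δ̃)` (the level `n = 1` lies
in every `𝒩_k`; kim3's `exists_kuriharaPartialDeepInfty_eq_natCast_of_kuriharaVanishingOrder_eq_zero`),
so the existential clause of the crux carries no content. [cite: MazurRubin2004, Def. 4.5.7, Def. 5.2.11] [cite: Kim2022StructureSelmer, §1.4.4 and §1.5.1 (PDF p. 7)] -/
theorem deepLower_conclusion_iff_le_add_deepInfty (hord : kuriharaVanishingOrder W p f = 0) (s : ℕ) :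
    (∃ d : ℕ, kuriharaPartialDeepInfty W p f = d ∧
        kuriharaPartial W p f 0 ≤ ((s + d : ℕ) : ℕ∞)) ↔
      kuriharaPartial W p f 0 ≤ (s : ℕ∞) + kuriharaPartialDeepInfty W p f := by
  constructor
  · rintro ⟨d, hd, hle⟩
    rw [hd, ← Nat.cast_add]
    exact hle
  · intro h
    obtain ⟨d, hd⟩ :=
      exists_kuriharaPartialDeepInfty_eq_natCast_of_kuriharaVanishingOrder_eq_zero W p f hord
    refine ⟨d, hd, ?_⟩
    rw [Nat.cast_add, ← hd]
    exact h

/-- **Any certified lower bound on the deep limit that covers the defect gives the crux at the row.**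
If `∂⁽⁰⁾(δ̃) ≤ s + e` and `e ≤ ∂^{(∞)}_{deep}(δ̃)` (every deep Kurihara number of every `ν` is
eventually `p^e`-divisible) then crux 19075's conclusion holds at the row (analytic rank `0`). With
`s = ord_p #Ш(p)` and `e = v_p(∏ c_ℓ)` the second hypothesis is «Tamagawa divisibility of deep
Kurihara numbers» (Kim 2022 Conj. 1.10, `≥` half, deep reading) and the first is the lower half of
`BSD_p` in `∂`-currency (§3). [cite: Kim2022StructureSelmer, Conj. 1.10 (PDF p. 8), §1.5.1 (PDF p. 7)]
[cite: MazurRubin2004, Def. 5.2.11, Thm. 5.2.12] -/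
theorem deepLower_conclusion_of_le_add_of_le_deepInfty (hord : kuriharaVanishingOrder W p f = 0)
    {s e : ℕ} (hslice : kuriharaPartial W p f 0 ≤ ((s + e : ℕ) : ℕ∞))
    (hdeep : (e : ℕ∞) ≤ kuriharaPartialDeepInfty W p f) :
    ∃ d : ℕ, kuriharaPartialDeepInfty W p f = d ∧
      kuriharaPartial W p f 0 ≤ ((s + d : ℕ) : ℕ∞) := by
  refine (deepLower_conclusion_iff_le_add_deepInfty W p f hord s).mpr (hslice.trans ?_)
  rw [Nat.cast_add]
  exact add_le_add le_rfl hdeep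

/-- **The slice `∂⁽⁰⁾(δ̃) ≤ s`** (`e = 0`): crux 19075's conclusion holds at every analytic-rank-`0` row
with `∂⁽⁰⁾(δ̃) ≤ s`; with `s = ord_p #Ш(p)` these are the rows where `δ̃₁ = [0]⁺_f` is AT MOST as
`p`-divisible as `#Ш` — containing kim3's unit slice `∂⁽⁰⁾ = 0` (`deepLowerAtThree_of_unitLevelOne`).
No Euler system, no fact. [cite: Kim2022StructureSelmer, §1.5.1 (PDF p. 7)] [cite: MazurRubin2004, Def. 5.2.11] -/
theorem deepLower_conclusion_of_kuriharaPartial_zero_le (hord : kuriharaVanishingOrder W p f = 0)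
    {s : ℕ} (hslice : kuriharaPartial W p f 0 ≤ (s : ℕ∞)) :
    ∃ d : ℕ, kuriharaPartialDeepInfty W p f = d ∧
      kuriharaPartial W p f 0 ≤ ((s + d : ℕ) : ℕ∞) :=
  deepLower_conclusion_of_le_add_of_le_deepInfty W p f hord (e := 0) (by simpa using hslice) zero_le

/-- **Conversely, the crux at a row whose deep limit is at most `e` gives `∂⁽⁰⁾ ≤ s + e`** (pure
`ℕ∞`; with `e = v_p(∏ c_ℓ)` this is w2-c3's `kuriharaPartial_zero_le_of_deepDefectLe_of_lower`, restated
with the crux's existential conclusion as the hypothesis). [cite: Kim2022StructureSelmer, Conj. 1.10 (PDF p. 8)] -/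
theorem kuriharaPartial_zero_le_add_of_deepLower_conclusion_of_deepInfty_le {s e : ℕ}
    (h : ∃ d : ℕ, kuriharaPartialDeepInfty W p f = d ∧
      kuriharaPartial W p f 0 ≤ ((s + d : ℕ) : ℕ∞))
    (hD : kuriharaPartialDeepInfty W p f ≤ (e : ℕ∞)) :
    kuriharaPartial W p f 0 ≤ ((s + e : ℕ) : ℕ∞) := by
  obtain ⟨d, hd, hle⟩ := h
  exact kuriharaPartial_zero_le_of_deepDefectLe_of_lower W p f hd hle hD

end Bookkeeping

/-! ### §2 The crux `DeepLowerAtThree` on the small-defect slices (`p = 3`, crux binders verbatim) -/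

section Crux

/-- **`DeepLowerAtThree` on the slice `∂⁽⁰⁾(δ̃) ≤ ord₃ #Ш(E/ℚ)(3)`, unconditionally.** The crux's binders
verbatim plus the one slice binder; conclusion verbatim. Contains kim3's unit-`δ̃₁` rung (`∂⁽⁰⁾ = 0`).
A rung of item `stmt-BirchSwinnertonDyer-19075`. [cite: Kim2022StructureSelmer, §1.5.1 (PDF p. 7)]
[cite: MazurRubin2004, Def. 5.2.11] -/
theorem deepLowerAtThree_of_kuriharaPartial_zero_le_sha :
    ∀ (W : WeierstrassCurve ℚ) [W.IsElliptic] [W.IsGloballyMinimal],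
      (∀ n : ℕ, W.HasSurjectiveModNGaloisRep (3 ^ n : ℕ)) →
      Finite W.sha →
      ∀ {N : ℕ} [NeZero N] (f : CuspForm (Gamma0 N) 2), IsNewformOf W f →
      (∀ r : ℚ, ratPlusSymbol f r ≠ 0 → 0 ≤ padicValRat 3 (ratPlusSymbol f r)) →
      kuriharaVanishingOrder W 3 f = 0 →
      kuriharaPartial W 3 f 0 ≤
        ((padicValNat 3 (Nat.card (AddCommGroup.primaryComponent W.sha 3)) : ℕ) : ℕ∞) →
        ∃ d : ℕ, kuriharaPartialDeepInfty W 3 f = d ∧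
          kuriharaPartial W 3 f 0 ≤
            ((padicValNat 3 (Nat.card (AddCommGroup.primaryComponent W.sha 3)) + d : ℕ) : ℕ∞) := by
  intro W _ _ _ _ N _ f _ _ hord hslice
  exact deepLower_conclusion_of_kuriharaPartial_zero_le W 3 f hord hslice

/-- **Cassels–Tate at `3`: a non-trivial `Ш(E/ℚ)(3)` has `9 ∣ #Ш(E/ℚ)`, i.e. `2 ≤ ord₃ #Ш(E/ℚ)(3)`**
(`Ш` finite). The pairing (named fact `exists_casselsTate_pairing`, Silverman X.4.14) makes `#Ш` a
perfect square (`isSquare_card_sha_of_finite_of_casselsTate`); `#Ш(3) = 3^{ord₃ #Ш} ≠ 1` gives `3 ∣ #Ш`,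
hence `9 ∣ #Ш`. [cite: SilvermanAEC2009, Thm. X.4.14 and Exercise 10.20] -/
theorem two_le_padicValNat_sha_three_of_casselsTate
    (hCT : WeierstrassCurve.exists_casselsTate_pairing (K := ℚ))
    (W : WeierstrassCurve ℚ) [W.IsElliptic] [Finite W.sha]
    (hne : Nat.card (AddCommGroup.primaryComponent W.sha 3) ≠ 1) :
    2 ≤ padicValNat 3 (Nat.card (AddCommGroup.primaryComponent W.sha 3)) := by
  haveI : Fact (Nat.Prime 3) := ⟨Nat.prime_three⟩
  have hcard0 : Nat.card W.sha ≠ 0 := Nat.card_pos.ne'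
  rw [padicValNat_card_addPrimaryComponent 3]
  -- `#Ш(3) = 3 ^ ord₃ #Ш ≠ 1`, so `1 ≤ ord₃ #Ш` and `3 ∣ #Ш`
  have hv1 : 1 ≤ padicValNat 3 (Nat.card W.sha) := by
    by_contra h0
    apply hne
    rw [card_addPrimaryComponent_eq_pow, Nat.factorization_def _ Nat.prime_three]
    have : padicValNat 3 (Nat.card W.sha) = 0 := by omega
    rw [this, pow_zero]
  have h3 : 3 ∣ Nat.card W.sha := by
    have := (padicValNat_dvd_iff_le hcard0).mpr hv1
    simpa using this
  -- `#Ш = m²` (Cassels–Tate) and `3 ∣ m² ⇒ 3 ∣ m ⇒ 9 ∣ #Ш`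
  obtain ⟨m, hm⟩ := isSquare_card_sha_of_finite_of_casselsTate hCT W
  have h3m : 3 ∣ m := by
    have : 3 ∣ m * m := hm ▸ h3
    exact (Nat.Prime.dvd_mul Nat.prime_three).mp this |>.elim id id
  have h9 : 3 ^ 2 ∣ Nat.card W.sha := by
    rw [hm, pow_two]
    exact Nat.mul_dvd_mul h3m h3m
  exact (padicValNat_dvd_iff_le hcard0).mp h9

/-- **The registered stub shape `stub_lower_shaNontrivial` on the slice `∂⁽⁰⁾(δ̃) ≤ 2`, GRANTED
Cassels–Tate by name.** Binders of `stub_lower_shaNontrivial` (crux 19075's binders + `#Ш(E/ℚ)(3) ≠ 1`)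
verbatim, then the slice binder `∂⁽⁰⁾(δ̃) ≤ 2`; conclusion verbatim. By
`two_le_padicValNat_sha_three_of_casselsTate`, `∂⁽⁰⁾ ≤ 2 ≤ ord₃ #Ш(3)` and §1 applies. (By the BSD
formula these are the rows with `#Ш(E)(3) = 9` exactly and `3 ∤ ∏ c_ℓ`, unit period transfer.)
[cite: SilvermanAEC2009, Thm. X.4.14] [cite: Kim2022StructureSelmer, §1.5.1 (PDF p. 7)] -/
theorem deepLowerAtThree_shaNontrivial_of_kuriharaPartial_zero_le_two_of_casselsTate
    (hCT : WeierstrassCurve.exists_casselsTate_pairing (K := ℚ)) :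
    ∀ (W : WeierstrassCurve ℚ) [W.IsElliptic] [W.IsGloballyMinimal],
      (∀ n : ℕ, W.HasSurjectiveModNGaloisRep (3 ^ n : ℕ)) →
      Finite W.sha →
      ∀ {N : ℕ} [NeZero N] (f : CuspForm (Gamma0 N) 2), IsNewformOf W f →
      (∀ r : ℚ, ratPlusSymbol f r ≠ 0 → 0 ≤ padicValRat 3 (ratPlusSymbol f r)) →
      kuriharaVanishingOrder W 3 f = 0 →
      Nat.card (AddCommGroup.primaryComponent W.sha 3) ≠ 1 →
      kuriharaPartial W 3 f 0 ≤ (2 : ℕ∞) →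
        ∃ d : ℕ, kuriharaPartialDeepInfty W 3 f = d ∧
          kuriharaPartial W 3 f 0 ≤
            ((padicValNat 3 (Nat.card (AddCommGroup.primaryComponent W.sha 3)) + d : ℕ) : ℕ∞) := by
  intro W _ _ _ hfin N _ f _ _ hord hne hslice
  refine deepLower_conclusion_of_kuriharaPartial_zero_le W 3 f hord (hslice.trans ?_)
  exact_mod_cast two_le_padicValNat_sha_three_of_casselsTate hCT W hne

/-- **The stub shape `stub_lower_shaNontrivial` on the slice `∂⁽⁰⁾(δ̃) ≤ 1`, with NO fact**:
`#Ш(E/ℚ)(3) ≠ 1` alone gives `1 ≤ ord₃ #Ш(3)` (a non-trivial finite `3`-group). [cite: Kim2022StructureSelmer, §1.5.1 (PDF p. 7)] -/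
theorem deepLowerAtThree_shaNontrivial_of_kuriharaPartial_zero_le_one :
    ∀ (W : WeierstrassCurve ℚ) [W.IsElliptic] [W.IsGloballyMinimal],
      (∀ n : ℕ, W.HasSurjectiveModNGaloisRep (3 ^ n : ℕ)) →
      Finite W.sha →
      ∀ {N : ℕ} [NeZero N] (f : CuspForm (Gamma0 N) 2), IsNewformOf W f →
      (∀ r : ℚ, ratPlusSymbol f r ≠ 0 → 0 ≤ padicValRat 3 (ratPlusSymbol f r)) →
      kuriharaVanishingOrder W 3 f = 0 →
      Nat.card (AddCommGroup.primaryComponent W.sha 3) ≠ 1 →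
      kuriharaPartial W 3 f 0 ≤ (1 : ℕ∞) →
        ∃ d : ℕ, kuriharaPartialDeepInfty W 3 f = d ∧
          kuriharaPartial W 3 f 0 ≤
            ((padicValNat 3 (Nat.card (AddCommGroup.primaryComponent W.sha 3)) + d : ℕ) : ℕ∞) := by
  intro W _ _ _ hfin N _ f _ _ hord hne hslice
  haveI : Fact (Nat.Prime 3) := ⟨Nat.prime_three⟩
  refine deepLower_conclusion_of_kuriharaPartial_zero_le W 3 f hord (hslice.trans ?_)
  have hv1 : 1 ≤ padicValNat 3 (Nat.card (AddCommGroup.primaryComponent W.sha 3)) := by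
    rw [padicValNat_card_addPrimaryComponent 3]
    by_contra h0
    apply hne
    rw [card_addPrimaryComponent_eq_pow, Nat.factorization_def _ Nat.prime_three]
    have : padicValNat 3 (Nat.card W.sha) = 0 := by omega
    rw [this, pow_zero]
  exact_mod_cast hv1

end Crux

/-! ### §3 BSD currency: the lower half of `BSD_p` bounds the defect by the Tamagawa exponent -/

section BSDCurrency

variable (W : WeierstrassCurve ℚ) [W.IsElliptic] [W.IsGloballyMinimal] (p : ℕ) [Fact p.Prime]
  {N : ℕ} [NeZero N] (f : CuspForm (Gamma0 N) 2)

/-- **Miller's lower half ⇒ the `∂`-currency lower half** (converse of w2-c3's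
`missingLowerBoundAt_of_kuriharaPartial_zero_le`). For odd `p`, `E[p]` irreducible (so `p ∤ #E(ℚ)_tors`),
`f` the newform of `W` with `ord(δ̃) = 0` (analytic rank `0`) and the `p`-adic period transfer
`Ω(W) = u · Ω⁺_f`, `|u|_p = 1`, granted Gross–Zagier–Kolyvagin `hGZK` (rank `0`, `Ш` finite):
`Typed.MissingLowerBoundAt W p` (`#Ш_an = q`, `ord_p q ≤ ord_p #Ш`) gives
`∂⁽⁰⁾(δ̃) ≤ ord_p #Ш(E/ℚ)(p) + v_p(∏ c_ℓ)` — since `#Ш_an = (L(E,1)/Ω(W))·#E(ℚ)²_tors/∏ c_ℓ` and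
`∂⁽⁰⁾(δ̃) = ord_p [0]⁺_f = ord_p(L(E,1)/Ω(W))`. [cite: Miller2011LMS, Def. 1.1]
[cite: Kim2022StructureSelmer, §1.4.3 and §1.5.1 (PDF p. 7)] -/
theorem kuriharaPartial_zero_le_sha_add_tamagawa_of_missingLowerBoundAt
    (hGZK : rank_eq_analyticRank_of_analyticRank_le_one) (hp2 : p ≠ 2)
    (hirr : W.HasIrreducibleModPGaloisRep p) (hf : IsNewformOf W f)
    (hord : kuriharaVanishingOrder W p f = 0)
    (hper : ∃ u : ℚ, ‖(u : ℚ_[p])‖ = 1 ∧ W.realPeriodRat = u * plusPeriod f)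
    (hlow : MissingLowerBoundAt W p) :
    kuriharaPartial W p f 0 ≤
      ((padicValNat p (Nat.card (AddCommGroup.primaryComponent W.sha p)) +
        padicValNat p W.tamagawaProduct : ℕ) : ℕ∞) := by
  have h0 : ratPlusSymbol f 0 ≠ 0 :=
    ratPlusSymbol_zero_ne_zero_of_kuriharaVanishingOrder_eq_zero W p f hord
  have hL : W.entireLFunction 1 ≠ 0 := hf.entireLFunction_one_ne_zero_of_ratPlusSymbol_zero_ne_zero h0
  have hr0 : W.analyticRank = 0 := analyticRank_eq_zero_of_entireLFunction_one_ne_zero hL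
  obtain ⟨-, hfin⟩ := hGZK W (by rw [hr0]; exact zero_le_one)
  haveI : Finite W.sha := hfin
  -- `∂⁽⁰⁾ = a` is finite; the witness `t = L(E,1)/Ω(W) ∈ ℚ`
  have hfin0 : kuriharaPartial W p f 0 < ⊤ := by
    rw [kuriharaPartial_zero]
    exact kuriharaDivIndex_one_lt_top_of_kuriharaVanishingOrder_eq_zero W p f hord
  obtain ⟨a, ha⟩ : ∃ a : ℕ, kuriharaPartial W p f 0 = a :=
    (ENat.ne_top_iff_exists.mp hfin0.ne).imp fun a h => h.symm
  obtain ⟨t, ht, -⟩ :=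
    exists_padicValRat_le_of_kuriharaPartial_zero_le W p f hp2 hirr hf hord hper (m := a) ha.le
  have hΩC : (W.realPeriodRat : ℂ) ≠ 0 := Complex.ofReal_ne_zero.mpr W.realPeriodRat_pos_holds.ne'
  have ht0 : t ≠ 0 := by
    rintro rfl
    apply hL
    have h' := ht
    rw [div_eq_iff hΩC] at h'
    rw [h']
    simp
  -- Miller's `q` IS `t · #tors² / ∏ c_ℓ`
  obtain ⟨q, hq, hv⟩ := hlow
  have hqt : q = t * (W.torsionOrder : ℚ) ^ 2 / (W.tamagawaProduct : ℚ) := by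
    have h1 := hq.symm.trans (shaAn_eq_of_analyticRank_eq_zero W hGZK hr0 ht)
    exact_mod_cast h1
  have hsha : padicValNat p (Nat.card (AddCommGroup.primaryComponent W.sha p)) =
      padicValNat p W.shaOrder := by
    unfold WeierstrassCurve.shaOrder
    exact padicValNat_card_addPrimaryComponent p
  rw [hqt, padicValRat_shaAn_witness W p hirr ht0, ← hsha] at hv
  -- `ord_p t ≤ ord_p #Ш(p) + v_p(∏ c_ℓ)`, then the `≤`-bridge
  have hv' : padicValRat p t ≤
      ((padicValNat p (Nat.card (AddCommGroup.primaryComponent W.sha p)) +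
        padicValNat p W.tamagawaProduct : ℕ) : ℤ) := by
    rw [Nat.cast_add]
    linarith
  exact kuriharaPartial_zero_le_natCast_of_padicValRat_le W p f hp2 hirr hf h0 hper ht hv'

/-- **Lower half of `BSD_p` ∧ «Tamagawa divisibility of deep Kurihara numbers» ⇒ crux 19075's
conclusion at the row** (general odd `p`, same row as above): `MissingLowerBoundAt W p` gives
`∂⁽⁰⁾ ≤ s + c` and `c = v_p(∏ c_ℓ) ≤ ∂^{(∞)}_{deep}` closes it (§1). [cite: Kim2022StructureSelmer, Conj. 1.10 (PDF p. 8), Thm. 1.9 (6)]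
[cite: Miller2011LMS, Def. 1.1] -/
theorem deepLower_conclusion_of_missingLowerBoundAt_of_tamagawa_le_deepInfty
    (hGZK : rank_eq_analyticRank_of_analyticRank_le_one) (hp2 : p ≠ 2)
    (hirr : W.HasIrreducibleModPGaloisRep p) (hf : IsNewformOf W f)
    (hord : kuriharaVanishingOrder W p f = 0)
    (hper : ∃ u : ℚ, ‖(u : ℚ_[p])‖ = 1 ∧ W.realPeriodRat = u * plusPeriod f)
    (hlow : MissingLowerBoundAt W p)
    (htam : ((padicValNat p W.tamagawaProduct : ℕ) : ℕ∞) ≤ kuriharaPartialDeepInfty W p f) :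
    ∃ d : ℕ, kuriharaPartialDeepInfty W p f = d ∧
      kuriharaPartial W p f 0 ≤
        ((padicValNat p (Nat.card (AddCommGroup.primaryComponent W.sha p)) + d : ℕ) : ℕ∞) :=
  deepLower_conclusion_of_le_add_of_le_deepInfty W p f hord
    (kuriharaPartial_zero_le_sha_add_tamagawa_of_missingLowerBoundAt W p f hGZK hp2 hirr hf hord hper hlow)
    htam

/-- **On the rows with `p ∤ ∏ c_ℓ` the lower half of `BSD_p` ALONE gives crux 19075's conclusion**
(`c = 0`). [cite: Kim2022StructureSelmer, Thm. 1.9 (6), §1.5.1 (PDF p. 7)] [cite: Miller2011LMS, Def. 1.1] -/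
theorem deepLower_conclusion_of_missingLowerBoundAt_of_not_dvd_tamagawa
    (hGZK : rank_eq_analyticRank_of_analyticRank_le_one) (hp2 : p ≠ 2)
    (hirr : W.HasIrreducibleModPGaloisRep p) (hf : IsNewformOf W f)
    (hord : kuriharaVanishingOrder W p f = 0)
    (hper : ∃ u : ℚ, ‖(u : ℚ_[p])‖ = 1 ∧ W.realPeriodRat = u * plusPeriod f)
    (hlow : MissingLowerBoundAt W p) (htam : ¬ p ∣ W.tamagawaProduct) :
    ∃ d : ℕ, kuriharaPartialDeepInfty W p f = d ∧
      kuriharaPartial W p f 0 ≤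
        ((padicValNat p (Nat.card (AddCommGroup.primaryComponent W.sha p)) + d : ℕ) : ℕ∞) := by
  refine deepLower_conclusion_of_missingLowerBoundAt_of_tamagawa_le_deepInfty W p f hGZK hp2 hirr hf
    hord hper hlow ?_
  rw [padicValNat.eq_zero_of_not_dvd htam, Nat.cast_zero]
  exact zero_le

end BSDCurrency

/-! ### §3′ Crux level at `p = 3` -/

/-- **`DeepLowerAtThree` from the lower half of `BSD₃` and Tamagawa divisibility, row by row.** On every
row of crux 19075 (binders verbatim) carrying the `3`-adic period transfer: granted GZK by name,
`MissingLowerBoundAt W 3` and `v₃(∏ c_ℓ) ≤ ∂^{(∞)}_{deep}(δ̃)` give the crux's conclusion. With w2-c3's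
`missingLowerBoundAt_three_of_deepDefectLe_of_deepLowerAtThree` (DDT ∧ 19075 ⇒ `MissingLowerBoundAt W 3`)
this places the crux: modulo the two Tamagawa inequalities it is the main-conjecture half of `BSD₃` on
the tower. [cite: Kim2025RefinedTNC, Thm. 1.1] [cite: Kim2022StructureSelmer, Conj. 1.10 (PDF p. 8)]
[cite: Miller2011LMS, Def. 1.1] -/
theorem deepLowerAtThree_row_of_missingLowerBoundAt_of_tamagawa_le_deepInfty
    (hGZK : rank_eq_analyticRank_of_analyticRank_le_one) :
    ∀ (W : WeierstrassCurve ℚ) [W.IsElliptic] [W.IsGloballyMinimal],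
      (∀ n : ℕ, W.HasSurjectiveModNGaloisRep (3 ^ n : ℕ)) →
      Finite W.sha →
      ∀ {N : ℕ} [NeZero N] (f : CuspForm (Gamma0 N) 2), IsNewformOf W f →
      (∀ r : ℚ, ratPlusSymbol f r ≠ 0 → 0 ≤ padicValRat 3 (ratPlusSymbol f r)) →
      kuriharaVanishingOrder W 3 f = 0 →
      (∃ u : ℚ, ‖(u : ℚ_[3])‖ = 1 ∧ W.realPeriodRat = u * plusPeriod f) →
      MissingLowerBoundAt W 3 →
      ((padicValNat 3 W.tamagawaProduct : ℕ) : ℕ∞) ≤ kuriharaPartialDeepInfty W 3 f →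
        ∃ d : ℕ, kuriharaPartialDeepInfty W 3 f = d ∧
          kuriharaPartial W 3 f 0 ≤
            ((padicValNat 3 (Nat.card (AddCommGroup.primaryComponent W.sha 3)) + d : ℕ) : ℕ∞) := by
  intro W _ _ htower _ N _ f hf _ hord hper hlow htam
  haveI : Fact (Nat.Prime 3) := ⟨Nat.prime_three⟩
  exact deepLower_conclusion_of_missingLowerBoundAt_of_tamagawa_le_deepInfty W 3 f hGZK (by norm_num)
    (hasIrreducibleModPGaloisRep_of_hasSurjectiveModNGaloisRep W 3 (by simpa using htower 1))
    hf hord hper hlow htam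

/-- **… and from the lower half of `BSD₃` ALONE on the rows with `3 ∤ ∏ c_ℓ`.** [cite: Miller2011LMS, Def. 1.1] -/
theorem deepLowerAtThree_row_of_missingLowerBoundAt_of_not_three_dvd_tamagawa
    (hGZK : rank_eq_analyticRank_of_analyticRank_le_one) :
    ∀ (W : WeierstrassCurve ℚ) [W.IsElliptic] [W.IsGloballyMinimal],
      (∀ n : ℕ, W.HasSurjectiveModNGaloisRep (3 ^ n : ℕ)) →
      Finite W.sha →
      ∀ {N : ℕ} [NeZero N] (f : CuspForm (Gamma0 N) 2), IsNewformOf W f →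
      (∀ r : ℚ, ratPlusSymbol f r ≠ 0 → 0 ≤ padicValRat 3 (ratPlusSymbol f r)) →
      kuriharaVanishingOrder W 3 f = 0 →
      (∃ u : ℚ, ‖(u : ℚ_[3])‖ = 1 ∧ W.realPeriodRat = u * plusPeriod f) →
      MissingLowerBoundAt W 3 → ¬ 3 ∣ W.tamagawaProduct →
        ∃ d : ℕ, kuriharaPartialDeepInfty W 3 f = d ∧
          kuriharaPartial W 3 f 0 ≤
            ((padicValNat 3 (Nat.card (AddCommGroup.primaryComponent W.sha 3)) + d : ℕ) : ℕ∞) := by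
  intro W _ _ htower _ N _ f hf _ hord hper hlow htam
  haveI : Fact (Nat.Prime 3) := ⟨Nat.prime_three⟩
  exact deepLower_conclusion_of_missingLowerBoundAt_of_not_dvd_tamagawa W 3 f hGZK (by norm_num)
    (hasIrreducibleModPGaloisRep_of_hasSurjectiveModNGaloisRep W 3 (by simpa using htower 1))
    hf hord hper hlow htam

end Summit.BirchSwinnertonDyer.BirchSwinnertonDyer.Theorems.KimAtThreeDeepLowerSmallDefect

end
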